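import Mathlib
import HarnessLib
import Summits.HubbardSuperconductivity.HubbardSuperconductivity.Theorems.WeakCouplingBCSWcbcsKohnLuttingerB1gKlCertWindowGlue
import Summits.HubbardSuperconductivity.HubbardSuperconductivity.Theorems.WeakCouplingBCSDefsKlCertB1gWinARecord
import Summits.HubbardSuperconductivity.HubbardSuperconductivity.Theorems.WeakCouplingBCSDefsKlCertB1gWinBRecord
import Summits.HubbardSuperconductivity.HubbardSuperconductivity.Theorems.WeakCouplingBCSDefsKlCertB1gWinCRecord

/-!
# Route `WeakCouplingBCS` — support item `WcbcsKohnLuttingerB1g` (stmt-HubbardSuperconductivity-0158):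
# `B1g` dominance on the WHOLE chemical-potential window `μ ∈ [-0.42749, -0.1775]` (hole dopings `δ ∈ [0.10, 0.20]`)

The three window records `klCertB1gWinA` (`μ ∈ [-0.42749, -0.3775]`, 10 boxes), `klCertB1gWinB` (`[-0.3775, -0.2275]`, 24 boxes) and
`klCertB1gWinC` (`[-0.2275, -0.1775]`, 10 boxes) are adjacent; each is accepted by the multiplicity-aware checker (`decide +kernel` in its
own file) and certifies, modulo its named enclosures, μ-uniform `B1g` dominance on its window (`klb1gd_window_U`).  Gluing
(`klb1gd_window_U_append3`) gives the statement on the union: for every `μ ∈ [-0.42749, -0.1775]` — an interval containing the free-band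
chemical potentials `μ(0.20) = -0.42669…` and `μ(0.10) = -0.17983…` of the hole dopings `δ = 0.20` and `δ = 0.10` (CERT-SREP, certified
quadrature) — every `0 < U < 1` and every channel `χ ≠ B1g`:
`channelInf ε₀ μ U B1g + γ U² ≤ channelInf ε₀ μ U χ` with `γ = min (min γ_A γ_B) γ_C > 0` (the three record margins).
The hypotheses are the three named numerical statements `klCertB1gWin{A,B,C}.EnclosuresB1g` (44 boxes × (E1, E2, 4 × E4) inequalities, each
μ-uniform on its box), certified outside Lean by interval arithmetic in two independent implementations (gate cell `gate-hubbard-kl`,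
HOME/MU-WINDOW.md).
-/

noncomputable section

-- the tree's namespace `Summit.<Summit>.<Problem>.Theorems` repeats the summit name by design (D-0017)
set_option linter.dupNamespace false

namespace Summit.HubbardSuperconductivity.HubbardSuperconductivity.Theorems

open Literature.MathematicalPhysics.QuantumLattice CwKLChiralWindow
open Summit.HubbardSuperconductivity.HubbardSuperconductivity.Theses.WeakCouplingBCS

/-- **`B1g` (`d_{x²-y²}`) dominance of the second-order Kohn–Luttinger vertex on the whole window `μ ∈ [-0.42749, -0.1775]`**
(⊃ `[μ(0.20), μ(0.10)]`), modulo the certified enclosures of the three window records: for every such `μ`, every `0 < U < 1` and every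
`χ ≠ B1g`, `channelInf ε₀ μ U B1g + γ·U² ≤ channelInf ε₀ μ U χ` with `γ = min (min γ_A γ_B) γ_C`, the record margins.
[cite: RaghuKivelsonScalapino2010, §III Fig. 2] -/
theorem klb1g_window_d010_d020 (hA : klCertB1gWinA.EnclosuresB1g) (hB : klCertB1gWinB.EnclosuresB1g)
    (hC : klCertB1gWinC.EnclosuresB1g) :
    ∀ μ ∈ Set.Icc (-0.42749 : ℝ) (-0.1775), ∀ U ∈ Set.Ioo (0 : ℝ) 1, ∀ χ : D4Irrep, χ ≠ D4Irrep.B1g →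
      channelInf (squareDispersion 1 0) μ U D4Irrep.B1g +
          min (min ((klCertB1gWinA.gamma : ℚ) : ℝ) ((klCertB1gWinB.gamma : ℚ) : ℝ)) ((klCertB1gWinC.gamma : ℚ) : ℝ) * U ^ 2 ≤
        channelInf (squareDispersion 1 0) μ U χ := by
  have h := klb1gd_window_U_append3 klCertB1gWinA klCertB1gWinB klCertB1gWinC klCertB1gWinA_check klCertB1gWinB_check
    klCertB1gWinC_check hA hB hC (by decide +kernel) (by decide +kernel)
  have hlo : (((klCertB1gWinA).mub : ℚ) : ℝ) = -0.42749 := by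
    show (((-42749 : ℚ) / 100000 : ℚ) : ℝ) = -0.42749
    push_cast; norm_num
  have hhi : (((klCertB1gWinC).mua : ℚ) : ℝ) = -0.1775 := by
    show (((-71 : ℚ) / 400 : ℚ) : ℝ) = -0.1775
    push_cast; norm_num
  intro μ hμ
  exact h μ (by rw [hlo, hhi]; exact hμ)

/-- The window margin is positive: `γ = min (min γ_A γ_B) γ_C > 0` (kernel decision on the three record rationals). [folklore] -/
theorem klb1g_window_d010_d020_gamma_pos :
    0 < min (min klCertB1gWinA.gamma klCertB1gWinB.gamma) klCertB1gWinC.gamma := by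
  decide +kernel

/-- **`WcbcsKohnLuttingerB1g` from the whole-window certificate** (any one of the three records already gives it; recorded here with
the window ends of the union, `U₁ = 1`). [cite: RaghuKivelsonScalapino2010, §III Fig. 2] -/
theorem wcbcsKohnLuttingerB1g_of_window_d010_d020 (hA : klCertB1gWinA.EnclosuresB1g) (hB : klCertB1gWinB.EnclosuresB1g)
    (hC : klCertB1gWinC.EnclosuresB1g) : WcbcsKohnLuttingerB1g := by
  have hγ : (0 : ℝ) < min (min ((klCertB1gWinA.gamma : ℚ) : ℝ) ((klCertB1gWinB.gamma : ℚ) : ℝ)) ((klCertB1gWinC.gamma : ℚ) : ℝ) := by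
    have h := klb1g_window_d010_d020_gamma_pos
    exact_mod_cast h
  refine wcbcsKohnLuttingerB1g_of_one_certificate (μ₁ := (-0.1775 : ℝ)) (μ₂ := (-0.42749 : ℝ)) (by norm_num) (by norm_num)
    (by norm_num) hγ ?_
  intro μ hμ χ hχ
  -- the `U = 1` form directly from the three window statements (`klb1gd_window`), glued on the real line
  have hμ' : μ ∈ Set.Icc (((klCertB1gWinA).mub : ℚ) : ℝ) (((klCertB1gWinC).mua : ℚ) : ℝ) := by
    have hlo : (((klCertB1gWinA).mub : ℚ) : ℝ) = -0.42749 := by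
      show (((-42749 : ℚ) / 100000 : ℚ) : ℝ) = -0.42749
      push_cast; norm_num
    have hhi : (((klCertB1gWinC).mua : ℚ) : ℝ) = -0.1775 := by
      show (((-71 : ℚ) / 400 : ℚ) : ℝ) = -0.1775
      push_cast; norm_num
    rw [hlo, hhi]; exact hμ
  have hAB : (((klCertB1gWinB).mub : ℚ) : ℝ) ≤ (((klCertB1gWinA).mua : ℚ) : ℝ) := by exact_mod_cast (show klCertB1gWinB.mub ≤ klCertB1gWinA.mua by decide +kernel)
  have hBC : (((klCertB1gWinC).mub : ℚ) : ℝ) ≤ (((klCertB1gWinB).mua : ℚ) : ℝ) := by exact_mod_cast (show klCertB1gWinC.mub ≤ klCertB1gWinB.mua by decide +kernel)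
  have wA := klb1gd_window klCertB1gWinA klCertB1gWinA_check hA
  have wB := klb1gd_window klCertB1gWinB klCertB1gWinB_check hB
  have wC := klb1gd_window klCertB1gWinC klCertB1gWinC_check hC
  by_cases hμA : μ ≤ (((klCertB1gWinA).mua : ℚ) : ℝ)
  · have := wA μ ⟨hμ'.1, hμA⟩ χ hχ
    have hm : min (min ((klCertB1gWinA.gamma : ℚ) : ℝ) ((klCertB1gWinB.gamma : ℚ) : ℝ)) ((klCertB1gWinC.gamma : ℚ) : ℝ) ≤
        ((klCertB1gWinA.gamma : ℚ) : ℝ) := (min_le_left _ _).trans (min_le_left _ _)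
    linarith
  · push Not at hμA
    by_cases hμB : μ ≤ (((klCertB1gWinB).mua : ℚ) : ℝ)
    · have := wB μ ⟨hAB.trans hμA.le, hμB⟩ χ hχ
      have hm : min (min ((klCertB1gWinA.gamma : ℚ) : ℝ) ((klCertB1gWinB.gamma : ℚ) : ℝ)) ((klCertB1gWinC.gamma : ℚ) : ℝ) ≤
          ((klCertB1gWinB.gamma : ℚ) : ℝ) := (min_le_left _ _).trans (min_le_right _ _)
      linarith
    · push Not at hμB
      have := wC μ ⟨hBC.trans hμB.le, hμ'.2⟩ χ hχ
      have hm : min (min ((klCertB1gWinA.gamma : ℚ) : ℝ) ((klCertB1gWinB.gamma : ℚ) : ℝ)) ((klCertB1gWinC.gamma : ℚ) : ℝ) ≤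
          ((klCertB1gWinC.gamma : ℚ) : ℝ) := min_le_right _ _
      linarith

end Summit.HubbardSuperconductivity.HubbardSuperconductivity.Theorems

end
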